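import Literature.NumberTheory.EllipticCurves.Wuthrich2014.ReducibleDivisibility
import Literature.NumberTheory.EllipticCurves.LeadingTermPPartEisensteinProofs
import HarnessLib

/-!
# Wuthrich 2014, Thm. 16 + Greenberg's Thm. 4.1 at `T = 0`: the ONE-SIDED rank-`0` `p`-part inequality at a reducible prime

`Proofs` companion (theorems only; no new definition, no new named fact) of
`Literature.NumberTheory.EllipticCurves.Wuthrich2014.ReducibleDivisibility` (the named fact
`charIdeal_dvd_padicLFunction` = C. Wuthrich, Doc. Math. 19 (2014), Thm. 16, good ordinary case).
HONEST FRAMING (BSD rank-≤1 residual cell `b2b-bsdres`): residual classes are deleted STRICTLY from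
published theorems; this file is the kernel form of the rank-`0` "chain" asked for class X1
(Eisenstein anomalous good `p`) and records precisely WHICH HALF of the `p`-part it yields.

The chain (Wuthrich 2014, proof of Prop. 21 = "the usual application" of Thm. 16; written out, with
the characteristic-ideal EQUALITY in place of the divisibility, as the proof of Castella–Grossi–Lee–Skinner,
Invent. Math. 227 (2022), Thm. 5.1.4, whose kernel form is the tree theorem
`padicValRat_bsd_rank_zero_of_mazurMainConjecture` of `LeadingTermPPartEisensteinProofs` — the
present proof follows it line by line): for `E/ℚ` (globally minimal `W`), `p ≠ 2` good ordinary with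
`E[p]` reducible and `L(E,1) ≠ 0`,
* Thm. 16 (`hW16`): `ϖ · L_p(f, α) = ι g` for some `g ∈ char_Λ X(E/ℚ_∞) = (f_E)`, so `g = h · f_E`,
  `h ∈ Λ`, and `g(0) = h(0) · f_E(0)` with `h(0) ∈ ℤ_p`;
* interpolation (Mazur–Swinnerton-Dyer; tree theorem `constantCoeff_padicLFunction_unitRoot`):
  `g(0) = ϖ (1 - α⁻¹)² [0]⁺_f = (1 - α⁻¹)² · L(E,1)/Ω_E`, non-zero, hence `f_E(0) ≠ 0` and
  `Sel_{p^∞}(E/ℚ)`, `E(ℚ)` are finite (Greenberg, LNM 1716, p. 103);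
* Greenberg's Thm. 4.1 (`hGr`, inline exactly as in the tree's rank-`0` glue):
  `f_E(0) · #E(ℚ)(p)² ∼ p^{ord_p ∏ c_ℓ} · #Ẽ(𝔽_p)(p)² · #Sel_{p^∞}(E/ℚ)`;
* `1 - α⁻¹ ∼ #Ẽ(𝔽_p) ∼ #Ẽ(𝔽_p)(p)` (the anomalous factor cancels, `exists_unit_one_sub_unitRoot_inv`),
  `#Sel = #Ш[p^∞] ∼ #Ш`, `#E(ℚ)(p) ∼ #E(ℚ)_tors`.
Taking valuations: `ord_p(L(E,1)/Ω_E) + 2 ord_p #E(ℚ)_tors = ord_p h(0) + ord_p ∏ c_ℓ + ord_p #Ш`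
with `ord_p h(0) ≥ 0`, i.e. **`ord_p #Ш + ord_p ∏ c_ℓ - 2 ord_p #E(ℚ)_tors ≤ ord_p(L(E,1)/Ω_E)`**
(`le_padicValRat_of_charIdeal_dvd_padicLFunction`) — equivalently `ord_p #Ш ≤ ord_p #Ш_an`. The
REVERSE inequality is exactly `ord_p h(0) = 0`, i.e. the reverse divisibility `(L_p) ⊆ char_Λ X` up to
a unit of `Λ` (the `μ`-part included); it is not supplied by any published theorem at an anomalous
Eisenstein prime of type (unramified, even)/(ramified, odd) (Greenberg–Vatsal 2000 Thm. 1.3 needs the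
opposite type; Castella–Grossi–Skinner 2025 Thm. 1 needs `φ|_{G_p} ∉ {1, ω}`). With the equality
(`hMC`) the same computation is `padicValRat_bsd_rank_zero_of_mazurMainConjecture`.

References: [Wuthrich2014] Thm. 16, Prop. 21; [GreenbergLNM1716] Thm. 4.1 (p. 102), p. 103;
[CastellaEtAl2021] Thm. 5.1.4 (proof); [MazurTateTeitelbaum1986Invent] §I.14.
-/

set_option autoImplicit false

noncomputable section

open scoped Classical MatrixGroups ModularForm

open CongruenceSubgroup WeierstrassCurve Literature.NumberTheory.EllipticCurves
  Literature.NumberTheory.EllipticCurves.ModularForms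

namespace Literature.NumberTheory.EllipticCurves.Wuthrich2014

/-- **The one-sided rank-`0` `p`-part inequality from Wuthrich's Thm. 16 and Greenberg's Thm. 4.1.**
Let `W` be a globally minimal model of `E/ℚ`, `p ≠ 2` a prime of good ordinary reduction (`hgood`,
`hord`) with `E[p]` reducible (`hred`), `L(E,1) ≠ 0` (`hL`) and `Ш(E/ℚ)` finite (`hfin`, Kolyvagin).
Assume modularity with an integral Manin constant (`hmod`, named fact), Greenberg's Euler-characteristic
formula LNM 1716 Thm. 4.1 for `(E, p)` (`hGr`, inline, same spelling as in
`padicValRat_bsd_rank_zero_of_mazurMainConjecture`) and Wuthrich's Thm. 16 (`hW16`, the named fact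
`charIdeal_dvd_padicLFunction`). Then `L(E,1)/Ω_E` is a rational `q` with
`ord_p #Ш(E) + ord_p ∏_ℓ c_ℓ - 2 ord_p #E(ℚ)_tors ≤ ord_p q`, i.e. `ord_p #Ш(E/ℚ) ≤ ord_p #Ш(E/ℚ)_an`.
(The reverse inequality would be `ord_p h(0) = 0` for the cofactor `h` with `ϖ L_p = ι(h · f_E)`; see
the module docstring.) [cite: Wuthrich2014, Thm. 16 (p. 393) and Prop. 21 (p. 400)]
[cite: GreenbergLNM1716, Thm. 4.1 (p. 102), proof of Lemma 4.2 (p. 103)]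
[cite: CastellaEtAl2021, Thm. 5.1.4 (proof, §5.1.3)] -/
theorem le_padicValRat_of_charIdeal_dvd_padicLFunction (hW16 : charIdeal_dvd_padicLFunction)
    (W : WeierstrassCurve ℚ) [W.IsElliptic] [W.IsGloballyMinimal] (p : ℕ) [Fact p.Prime]
    (hp : p ≠ 2) (hgood : W.HasGoodReductionAtPrime p) (hord : ¬ (p : ℤ) ∣ W.frobeniusTrace p)
    (hred : ¬ W.HasIrreducibleModPGaloisRep p)
    (hL : W.entireLFunction 1 ≠ 0) (hfin : Finite W.sha)
    (hmod : nonempty_modularParametrizationData)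
    (hGr : ∀ (κ : ZpExtension ℚ p) (γ : Field.absoluteGaloisGroup ℚ),
        κ.IsCyclotomic → κ.IsTopGenerator γ → IsCyclotomicVariable p γ →
      ∀ (D : W.SelmerDualData κ γ) [Module.Finite (IwasawaAlgebra p) D.X], D.IsTorsion →
      ∀ (fE : IwasawaAlgebra p), D.charIdeal = Ideal.span {fE} →
        Finite (W.selmerGroupPInfty p) →
        ∃ u : ℤ_[p]ˣ,
          ((PowerSeries.constantCoeff fE : ℤ_[p]) : ℚ_[p]) *
              (Nat.card (AddCommGroup.primaryComponent W.toAffine.Point p) : ℚ_[p]) ^ 2 =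
            ((u : ℤ_[p]) : ℚ_[p]) * (p : ℚ_[p]) ^ (padicValNat p W.tamagawaProduct) *
              (Nat.card (AddCommGroup.primaryComponent
                ((integralModelInt W).map (Int.castRingHom (ZMod p))).toAffine.Point p) : ℚ_[p]) ^ 2 *
              (Nat.card (W.selmerGroupPInfty p) : ℚ_[p])) :
    ∃ q : ℚ, W.entireLFunction 1 / (W.realPeriodRat : ℂ) = (q : ℂ) ∧
      (padicValNat p W.shaOrder : ℤ) + padicValNat p W.tamagawaProduct -
        2 * padicValNat p W.torsionOrder ≤ padicValRat p q := by
  have hpP : p.Prime := Fact.out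
  have hordp : IsOrdinaryAt W p := ⟨hgood, hord⟩
  -- Step 0 (modularity): the newform `f` of `E` at level `N_E` and the period ratio `ϖ`
  haveI : NeZero (W.conductorNorm ℤ) := ⟨(W.conductorNorm_pos_holds).ne'⟩
  obtain ⟨Dm⟩ := hmod W
  set f := Dm.f with hf_def
  have hf : IsNewformOf W f := Dm.isNewformOf
  obtain ⟨ϖ, hϖpos, hϖeq, hΩpos⟩ := Dm.exists_rat_mul_realPeriodRat_eq_plusPeriod
  -- the rational number `t = ϖ · [0]⁺_f = L(E,1)/Ω_E`
  set s : ℚ := ratPlusSymbol f 0 with hs_def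
  set t : ℚ := ϖ * s with ht_def
  have hLval : W.entireLFunction 1 = (((s : ℝ) * plusPeriod f : ℝ) : ℂ) := hf.entireLFunction_one_eq
  have hq : W.entireLFunction 1 / (W.realPeriodRat : ℂ) = ((t : ℚ) : ℂ) := by
    rw [hLval, ← hϖeq, div_eq_iff (Complex.ofReal_ne_zero.mpr hΩpos.ne'), ht_def]
    push_cast
    ring
  have hs0 : s ≠ 0 := by
    intro h0
    apply hL
    rw [hLval, h0]
    simp
  have ht0 : t ≠ 0 := mul_ne_zero hϖpos.ne' hs0
  refine ⟨t, hq, ?_⟩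
  -- Step 1 (the cyclotomic setting and the Iwasawa module)
  obtain ⟨κ, hκ, γ, hγ, hγ'⟩ := exists_isCyclotomic_isTopGenerator_isCyclotomicVariable_holds p
  obtain ⟨D⟩ := W.nonempty_selmerDualData_holds κ γ hγ
  haveI : Module.Finite (IwasawaAlgebra p) D.X := D.module_finite_holds hγ
  -- Step 2 (Wuthrich's Thm. 16): `X` torsion and `ι g = ϖ · L_p(f, α)` for some `g ∈ char_Λ X`;
  -- a generator `fE` of the (principal) characteristic ideal, and the cofactor `h`: `g = h · fE`
  obtain ⟨hX, g, hgmem, hιg⟩ := hW16 W p hp hordp hred hκ hγ hγ' hf D ϖ hϖeq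
  haveI : (Module.charIdeal (IwasawaAlgebra p) D.X).IsPrincipal := charIdeal_isPrincipal_holds p D.X
  obtain ⟨fE, hchar⟩ := Submodule.IsPrincipal.principal (Module.charIdeal (IwasawaAlgebra p) D.X)
  have hchar' : D.charIdeal = Ideal.span {fE} := hchar
  have hgmem' : g ∈ Ideal.span {fE} := by rw [← hchar']; exact hgmem
  obtain ⟨h, hgh⟩ := Ideal.mem_span_singleton'.mp hgmem'
  -- Step 3 (interpolation): `g(0) = ϖ · (1 - α⁻¹)² [0]⁺_f = (1 - α⁻¹)² · t`
  set a : ℚ_[p] := ((unitRoot W p : ℤ_[p]) : ℚ_[p]) with ha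
  have htcast : ((t : ℚ) : ℚ_[p]) = (ϖ : ℚ_[p]) * (s : ℚ_[p]) := by
    rw [ht_def]; push_cast; ring
  have hg0 : ((PowerSeries.constantCoeff g : ℤ_[p]) : ℚ_[p]) = (1 - a⁻¹) ^ 2 * (t : ℚ_[p]) := by
    rw [← constantCoeff_iwasawaToPowerSeries p g, hιg, map_mul, PowerSeries.constantCoeff_C,
      constantCoeff_padicLFunction_unitRoot hordp hf, htcast]
    ring
  -- `g(0) = h(0) · fE(0)`
  have hg0' : (PowerSeries.constantCoeff g : ℤ_[p]) =
      PowerSeries.constantCoeff h * PowerSeries.constantCoeff fE := by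
    rw [← hgh, map_mul]
  -- the bridges `1 - α⁻¹ = u₂ · #Ẽ(𝔽_p)` and `#Ẽ(𝔽_p) = u₃ · #Ẽ(𝔽_p)(p)`; in particular `1 - α⁻¹ ≠ 0`
  obtain ⟨u₂, hu₂⟩ := exists_unit_one_sub_unitRoot_inv p W hordp
  haveI : NeZero p := ⟨hpP.ne_zero⟩
  obtain ⟨u₃, hu₃⟩ := exists_unit_natCard_eq_mul_card_primaryComponent
    ((integralModelInt W).map (Int.castRingHom (ZMod p))).toAffine.Point p
  set Np : ℚ_[p] := (Nat.card (AddCommGroup.primaryComponent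
    ((integralModelInt W).map (Int.castRingHom (ZMod p))).toAffine.Point p) : ℚ_[p]) with hNp
  have hNcount : (W.reductionPointCount p : ℚ_[p]) = ((u₃ : ℤ_[p]) : ℚ_[p]) * Np := by
    rw [WeierstrassCurve.reductionPointCount, hNp]
    exact hu₃
  have hNp0 : Np ≠ 0 := by
    rw [hNp]
    exact_mod_cast Nat.card_pos.ne'
  have h1 : (1 - a⁻¹) = ((u₂ : ℤ_[p]) : ℚ_[p]) * ((u₃ : ℤ_[p]) : ℚ_[p]) * Np := by
    rw [hu₂, hNcount, mul_assoc]
  have htQ0 : (t : ℚ_[p]) ≠ 0 := by exact_mod_cast ht0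
  have hU0 : ((u₂ : ℤ_[p]) : ℚ_[p]) * ((u₃ : ℤ_[p]) : ℚ_[p]) ≠ 0 :=
    mul_ne_zero (coe_units_ne_zero p u₂) (coe_units_ne_zero p u₃)
  -- Step 4 (finiteness): `g(0) ≠ 0`, hence `fE(0) ≠ 0` and `h(0) ≠ 0`, so `Sel_{p^∞}(E/ℚ)` and
  -- `E(ℚ)` are finite (Greenberg p. 103); `Ш` is finite by hypothesis
  have hg00 : PowerSeries.constantCoeff g ≠ 0 := by
    intro h0
    rw [h0, PadicInt.coe_zero, h1] at hg0
    exact (mul_ne_zero (pow_ne_zero 2 (mul_ne_zero hU0 hNp0)) htQ0) hg0.symm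
  have hfE00 : PowerSeries.constantCoeff fE ≠ 0 := by
    intro h0
    apply hg00
    rw [hg0', h0, mul_zero]
  have hh00 : PowerSeries.constantCoeff h ≠ 0 := by
    intro h0
    apply hg00
    rw [hg0', h0, zero_mul]
  have hSelfin : Finite (W.selmerGroupPInfty p) :=
    D.finite_selmerGroupPInfty_of_constantCoeff_ne_zero W hγ hX fE hchar' hfE00
  obtain ⟨hEfin, hShapfin⟩ := (W.finite_selmerGroupPInfty_iff p).mp hSelfin
  haveI := hEfin
  haveI := hShapfin
  haveI := hSelfin
  haveI : Finite W.sha := hfin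
  -- Step 5 (Greenberg's Thm. 4.1, for the generator `fE`)
  obtain ⟨u₁, hu₁⟩ := hGr κ γ hκ hγ hγ' D hX fE hchar' hSelfin
  -- Step 6 (the remaining bridges)
  obtain ⟨u₄, hu₄⟩ := exists_unit_torsionOrder_eq W p
  obtain ⟨u₅, hu₅⟩ := exists_unit_natCard_eq_mul_card_primaryComponent W.sha p
  have hSel : Nat.card (W.selmerGroupPInfty p) = Nat.card (AddCommGroup.primaryComponent W.sha p) :=
    W.natCard_selmerGroupPInfty_eq_natCard_primaryComponent_sha p
  -- abbreviations
  set v := padicValNat p W.tamagawaProduct with hv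
  set Tp : ℚ_[p] := (Nat.card (AddCommGroup.primaryComponent W.toAffine.Point p) : ℚ_[p]) with hTp
  set Shp : ℚ_[p] := (Nat.card (AddCommGroup.primaryComponent W.sha p) : ℚ_[p]) with hShp
  set h0 : ℚ_[p] := ((PowerSeries.constantCoeff h : ℤ_[p]) : ℚ_[p]) with hh0
  have hh0ne : h0 ≠ 0 := by
    rw [hh0]
    intro h0'
    exact hh00 (by exact_mod_cast (PadicInt.coe_eq_zero.mp h0'))
  have hh0val : 0 ≤ h0.valuation := by
    rw [hh0]
    exact PadicInt.valuation_coe_nonneg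
  -- `#E(ℚ)_tors = u₄ · Tp` (up to the `DecidableEq ℚ` instance inside the group law)
  have hu₄' : (W.torsionOrder : ℚ_[p]) = ((u₄ : ℤ_[p]) : ℚ_[p]) * Tp := by
    rw [hu₄, hTp]
    congr 1
    exact_mod_cast natCard_primaryComponent_point_congr W p _ _
  -- `#Ш = u₅ · Shp`, `#Sel = Shp`
  have hSha : (W.shaOrder : ℚ_[p]) = ((u₅ : ℤ_[p]) : ℚ_[p]) * Shp := by
    rw [WeierstrassCurve.shaOrder, hShp]
    exact hu₅
  have hSel' : (Nat.card (W.selmerGroupPInfty p) : ℚ_[p]) = Shp := by rw [hShp, hSel]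
  -- `g(0) = h0 · fE(0)` in `ℚ_p`
  have hg0Q : ((PowerSeries.constantCoeff g : ℤ_[p]) : ℚ_[p]) =
      h0 * ((PowerSeries.constantCoeff fE : ℤ_[p]) : ℚ_[p]) := by
    rw [hg0', hh0]; push_cast; ring
  -- Step 7: the identity `t · Tp² · (u₂ u₃)² = h0 · u₁ · p^v · Shp` in `ℚ_p`
  have key : (t : ℚ_[p]) * Tp ^ 2 * (((u₂ : ℤ_[p]) : ℚ_[p]) * ((u₃ : ℤ_[p]) : ℚ_[p])) ^ 2 =
      h0 * (((u₁ : ℤ_[p]) : ℚ_[p]) * (p : ℚ_[p]) ^ v * Shp) := by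
    apply mul_right_cancel₀ (pow_ne_zero 2 hNp0)
    calc (t : ℚ_[p]) * Tp ^ 2 * (((u₂ : ℤ_[p]) : ℚ_[p]) * ((u₃ : ℤ_[p]) : ℚ_[p])) ^ 2 * Np ^ 2
        = ((1 - a⁻¹) ^ 2 * (t : ℚ_[p])) * Tp ^ 2 := by rw [h1]; ring
      _ = h0 * (((PowerSeries.constantCoeff fE : ℤ_[p]) : ℚ_[p]) * Tp ^ 2) := by
          rw [← hg0, hg0Q]; ring
      _ = h0 * (((u₁ : ℤ_[p]) : ℚ_[p]) * (p : ℚ_[p]) ^ v * Np ^ 2 *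
            (Nat.card (W.selmerGroupPInfty p) : ℚ_[p])) := by rw [hu₁]
      _ = h0 * (((u₁ : ℤ_[p]) : ℚ_[p]) * (p : ℚ_[p]) ^ v * Shp) * Np ^ 2 := by rw [hSel']; ring
  -- Step 8: valuations
  have hTp0 : Tp ≠ 0 := by rw [hTp]; exact_mod_cast Nat.card_pos.ne'
  have hShp0 : Shp ≠ 0 := by rw [hShp]; exact_mod_cast Nat.card_pos.ne'
  have hp0 : (p : ℚ_[p]) ≠ 0 := Nat.cast_ne_zero.mpr hpP.ne_zero
  have hval := congrArg Padic.valuation key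
  rw [Padic.valuation_mul (mul_ne_zero htQ0 (pow_ne_zero 2 hTp0)) (pow_ne_zero 2 hU0),
    Padic.valuation_mul htQ0 (pow_ne_zero 2 hTp0), Padic.valuation_pow, Padic.valuation_pow,
    Padic.valuation_mul (coe_units_ne_zero p u₂) (coe_units_ne_zero p u₃),
    valuation_coe_units_eq_zero, valuation_coe_units_eq_zero,
    Padic.valuation_mul hh0ne
      (mul_ne_zero (mul_ne_zero (coe_units_ne_zero p u₁) (pow_ne_zero v hp0)) hShp0),
    Padic.valuation_mul (mul_ne_zero (coe_units_ne_zero p u₁) (pow_ne_zero v hp0)) hShp0,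
    Padic.valuation_mul (coe_units_ne_zero p u₁) (pow_ne_zero v hp0), valuation_coe_units_eq_zero,
    Padic.valuation_pow, Padic.valuation_p, Padic.valuation_ratCast] at hval
  -- `v(Tp) = v(#E(ℚ)_tors)`, `v(Shp) = v(#Ш)`
  have hvT : Tp.valuation = (padicValNat p W.torsionOrder : ℤ) := by
    have h := congrArg Padic.valuation hu₄'
    rw [Padic.valuation_natCast, Padic.valuation_mul (coe_units_ne_zero p u₄) hTp0,
      valuation_coe_units_eq_zero, zero_add] at h
    exact h.symm
  have hvS : Shp.valuation = (padicValNat p W.shaOrder : ℤ) := by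
    have h := congrArg Padic.valuation hSha
    rw [Padic.valuation_natCast, Padic.valuation_mul (coe_units_ne_zero p u₅) hShp0,
      valuation_coe_units_eq_zero, zero_add] at h
    exact h.symm
  rw [hvT, hvS] at hval
  simp only [Nat.cast_ofNat, mul_zero, add_zero, zero_add] at hval
  linarith

end Literature.NumberTheory.EllipticCurves.Wuthrich2014

end
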